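import Summits.QuantumFields.GaugeBoot.FluctuationCenteredEquation
import Summits.QuantumFields.GaugeBoot.FluctuationCovariance
import HarnessLib

/-!
# Fluctuations of Wilson loops, VII: the truncated power-series model (gauge-boot, ADDENDUM 32 part G)

HONEST FRAMING (cell `pub-gaugeboot`, page 1 of every file): the venture produces certified bounds
on lattice expectations at stated coupling, gauge group, dimension and torus size; NOT a mass gap,
NOT a continuum limit, NOT a string tension; NOT Yang–Mills-summit-bearing (barriers
`FixedCouplingUltralocality`, `PerturbativeInvisibility`).  Strong-coupling `SO(N)` lattice gauge theory with free boundary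
condition (S. Chatterjee, Comm. Math. Phys. **366** (2019); S. Chatterjee, J. Jafarov, arXiv:1604.04777); nothing about
four-dimensional continuum Yang–Mills or a mass gap.

## Content

At a fixed coupling `β` only finitely many orders of the `1/N` hierarchy are available (`|β| ≤ β₀(d,K)`), so the moment
functional `P(s) = Σ_k f_k(β,s) X^k ∈ ℝ⟦X⟧` obeys the hierarchy only MODULO `X^{K+1}`.  This file sets up the quotient
`Q_K = ℝ⟦X⟧ ⧸ (X^{K+1})` (`mk_eq_of_coeff_eq`, `coeff_eq_of_mk_eq`), proves the hierarchy identity for the image of `P` in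
`Q_K` (`hierarchy_mod`) from the order-by-order recursion up to order `K`, the permutation invariance of the coefficients
(`expansion_coeff_perm`, from the permutation invariance of `⟨W_{l₁}⋯W_{lₙ}⟩` and the uniqueness of the expansion) and of the
image of `P` (`P_mod_perm`), and `P(∅) = 1` modulo `X^{K+1}` (`P_mod_nil`).

Everything is `[folklore]`/`[new (lane)]` bookkeeping given parts A–F.
-/

noncomputable section

open Finset Filter Topology PowerSeries
open Literature.Probability.LatticeModels (Site box)
open Literature.MathematicalPhysics.QuantumFieldTheory.Chatterjee2019LargeN

namespace Summit.QuantumFields.GaugeBoot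

namespace StringDuality

variable {d : ℕ}

/-! ## The quotient `ℝ⟦X⟧ ⧸ (X^{K+1})` -/

/-- Power series with the same coefficients up to order `K` have the same image modulo `X^{K+1}`. [folklore] -/
theorem mk_eq_of_coeff_eq {K : ℕ} {a b : PowerSeries ℝ} (h : ∀ k, k ≤ K → coeff k a = coeff k b) :
    Ideal.Quotient.mk (Ideal.span {(X : PowerSeries ℝ) ^ (K + 1)}) a =
      Ideal.Quotient.mk (Ideal.span {(X : PowerSeries ℝ) ^ (K + 1)}) b := by
  rw [Ideal.Quotient.eq, Ideal.mem_span_singleton]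
  exact X_pow_dvd_iff.mpr fun m hm => by rw [map_sub, h m (Nat.lt_succ_iff.mp hm), sub_self]

/-- Conversely, equal images modulo `X^{K+1}` have the same coefficients up to order `K`. [folklore] -/
theorem coeff_eq_of_mk_eq {K : ℕ} {a b : PowerSeries ℝ}
    (h : Ideal.Quotient.mk (Ideal.span {(X : PowerSeries ℝ) ^ (K + 1)}) a =
      Ideal.Quotient.mk (Ideal.span {(X : PowerSeries ℝ) ^ (K + 1)}) b) :
    ∀ k, k ≤ K → coeff k a = coeff k b := by
  intro k hk
  rw [Ideal.Quotient.eq, Ideal.mem_span_singleton] at h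
  have h' := X_pow_dvd_iff.mp h k (Nat.lt_succ_iff.mpr hk)
  rw [map_sub] at h'
  linarith

/-- Coefficients of `X² · a`. [folklore] -/
theorem coeff_X_sq_mul (a : PowerSeries ℝ) (k : ℕ) :
    coeff 0 (X ^ 2 * a) = 0 ∧ coeff 1 (X ^ 2 * a) = 0 ∧ coeff (k + 2) (X ^ 2 * a) = coeff k a := by
  refine ⟨?_, ?_, ?_⟩
  · rw [coeff_X_pow_mul', if_neg (by norm_num)]
  · rw [coeff_X_pow_mul', if_neg (by norm_num)]
  · rw [coeff_X_pow_mul', if_pos (by omega), Nat.add_sub_cancel]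

/-! ## Permutation invariance of the `1/N` coefficients -/

/-- `φ_{Λ,N,β}` is invariant under permutations of the component loops (`W_{l₁}⋯W_{lₙ}` is a commutative product).
[cite: Chatterjee2019LargeN, §3 (definition of φ(s))] -/
theorem phi_perm (N : ℕ) (β : ℝ) (Λ : Finset (Site d)) {s s' : LoopSeq d} (h : s.Perm s') :
    phi N β Λ s = phi N β Λ s' := by
  unfold phi soExpect
  have hw : wilsonProd N s = wilsonProd N s' := by
    funext U
    unfold wilsonProd
    exact (h.map _).prod_eq
  rw [hw, h.length_eq]

/-- **The `1/N` coefficients are symmetric in the component loops**: a family with the expansion property up to order `K`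
takes the same values on permuted genuine loop sequences (limits are unique). [folklore] -/
theorem expansion_coeff_perm {β : ℝ} {K : ℕ} {F : ℕ → ℝ → LoopSeq d → ℝ}
    (hF : ∀ k, k ≤ K → ∀ s : LoopSeq d, IsLoopSeq s →
      Tendsto (fun N : ℕ => (N : ℝ) ^ k *
        (phi N β (box d N) s - ∑ i ∈ Finset.range k, F (i + 2) β s / (N : ℝ) ^ i)) atTop (𝓝 (F (k + 2) β s))) :
    ∀ k, k ≤ K → ∀ s s' : LoopSeq d, IsLoopSeq s → s.Perm s' → F (k + 2) β s = F (k + 2) β s' := by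
  intro k
  induction k using Nat.strong_induction_on with
  | _ k ih =>
  intro hk s s' hs hss'
  have hs' : IsLoopSeq s' := isLoopSeq_of_perm hs hss'
  have heq : (fun N : ℕ => (N : ℝ) ^ k * (phi N β (box d N) s - ∑ i ∈ Finset.range k, F (i + 2) β s / (N : ℝ) ^ i)) =
      fun N : ℕ => (N : ℝ) ^ k * (phi N β (box d N) s' - ∑ i ∈ Finset.range k, F (i + 2) β s' / (N : ℝ) ^ i) := by
    funext N
    rw [phi_perm N β (box d N) hss']
    congr 2
    exact Finset.sum_congr rfl fun i hi => by
      rw [ih i (Finset.mem_range.mp hi) (by have := Finset.mem_range.mp hi; omega) s s' hs hss']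
  have h1 := hF k hk s hs
  rw [heq] at h1
  exact tendsto_nhds_unique h1 (hF k hk s' hs')

/-! ## The moment functional modulo `X^{K+1}` -/

section model

variable {β : ℝ} {K : ℕ} {F : ℕ → ℝ → LoopSeq d → ℝ}

/-- **The hierarchy modulo `X^{K+1}`.**  With `P(u) = Σ_k F_{k+2}(β,u) X^k`, for every genuine non-null `s` the symmetrized
finite-`N` master loop equation holds in `ℝ⟦X⟧ ⧸ (X^{K+1})` with `X` in place of `1/N`:
`|s|P(s) − (Σ_{𝕊⁻}P − Σ_{𝕊⁺}P + β(Σ_{𝔻⁻}P − Σ_{𝔻⁺}P)) ≡ X(|s|P(s) + Σ_{𝕋⁻}P − Σ_{𝕋⁺}P) + X²(Σ_{𝕄⁻}P − Σ_{𝕄⁺}P)`.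
[cite: Chatterjee2019LargeN, Theorem 3.6; ChatterjeeJafarov2016OneOverN, Theorem 5.1 (5.2)] -/
theorem hierarchy_mod (hF0 : ∀ u : LoopSeq d, F 0 β u = 0) (hF1 : ∀ u : LoopSeq d, F 1 β u = 0)
    (hrec : ∀ k, k ≤ K → ∀ s : LoopSeq d, IsLoopSeq s → s ≠ [] →
      (s.len : ℝ) * F (k + 2) β s -
          ((∑ o : InvIdx s, F (k + 2) β (s.negSplitAt o)) - (∑ o : SameIdx s, F (k + 2) β (s.posSplitAt o))
            + β * (∑ o : DeformIdx s, F (k + 2) β (s.negDeformAt o))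
            - β * (∑ o : DeformIdx s, F (k + 2) β (s.posDeformAt o))) =
        (s.len : ℝ) * F (k + 1) β s
          + ((∑ o : SameIdx s, F (k + 1) β (s.negTwistAt o)) - ∑ o : InvIdx s, F (k + 1) β (s.posTwistAt o))
          + ((∑ o : MergeIdx s, F k β (s.negMergeAt o)) - ∑ o : MergeIdx s, F k β (s.posMergeAt o)))
    (s : LoopSeq d) (hs : IsLoopSeq s) (hne : s ≠ []) :
    Ideal.Quotient.mk (Ideal.span {(X : PowerSeries ℝ) ^ (K + 1)})
        ((s.len : PowerSeries ℝ) * PowerSeries.mk (fun k => F (k + 2) β s)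
          - (((∑ o : InvIdx s, PowerSeries.mk (fun k => F (k + 2) β (s.negSplitAt o)))
              - ∑ o : SameIdx s, PowerSeries.mk (fun k => F (k + 2) β (s.posSplitAt o)))
            + C β * ((∑ o : DeformIdx s, PowerSeries.mk (fun k => F (k + 2) β (s.negDeformAt o)))
              - ∑ o : DeformIdx s, PowerSeries.mk (fun k => F (k + 2) β (s.posDeformAt o))))) =
      Ideal.Quotient.mk (Ideal.span {(X : PowerSeries ℝ) ^ (K + 1)})
        (X * ((s.len : PowerSeries ℝ) * PowerSeries.mk (fun k => F (k + 2) β s)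
            + ((∑ o : SameIdx s, PowerSeries.mk (fun k => F (k + 2) β (s.negTwistAt o)))
              - ∑ o : InvIdx s, PowerSeries.mk (fun k => F (k + 2) β (s.posTwistAt o))))
          + X ^ 2 * ((∑ o : MergeIdx s, PowerSeries.mk (fun k => F (k + 2) β (s.negMergeAt o)))
              - ∑ o : MergeIdx s, PowerSeries.mk (fun k => F (k + 2) β (s.posMergeAt o)))) := by
  refine mk_eq_of_coeff_eq fun k hk => ?_
  set A : PowerSeries ℝ := (s.len : PowerSeries ℝ) * PowerSeries.mk (fun k => F (k + 2) β s)
            + ((∑ o : SameIdx s, PowerSeries.mk (fun k => F (k + 2) β (s.negTwistAt o)))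
              - ∑ o : InvIdx s, PowerSeries.mk (fun k => F (k + 2) β (s.posTwistAt o))) with hA
  set B : PowerSeries ℝ := (∑ o : MergeIdx s, PowerSeries.mk (fun k => F (k + 2) β (s.negMergeAt o)))
              - ∑ o : MergeIdx s, PowerSeries.mk (fun k => F (k + 2) β (s.posMergeAt o)) with hB
  have hnat : ∀ (a : PowerSeries ℝ) (j : ℕ), coeff j ((s.len : PowerSeries ℝ) * a) = (s.len : ℝ) * coeff j a := by
    intro a j
    rw [← map_natCast (C (R := ℝ)) s.len, coeff_C_mul]
  have h := hrec k hk s hs hne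
  obtain ⟨hB0, hB1, hB2⟩ := coeff_X_sq_mul B k
  rcases k with _ | _ | k
  · rw [map_add, coeff_zero_X_mul, hB0]
    simp only [map_sub, map_add, map_sum, coeff_C_mul, hnat, coeff_mk, add_zero]
    simp only [hF1, hF0, mul_zero, Finset.sum_const_zero, sub_self, add_zero] at h
    ring_nf at h ⊢
    linarith
  · rw [map_add, coeff_succ_X_mul, hB1, hA]
    simp only [map_sub, map_add, map_sum, coeff_C_mul, hnat, coeff_mk, add_zero]
    simp only [hF1, Finset.sum_const_zero, sub_self, add_zero] at h
    ring_nf at h ⊢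
    linarith
  · obtain ⟨-, -, hBk⟩ := coeff_X_sq_mul B k
    rw [map_add, coeff_succ_X_mul, hBk, hA, hB]
    simp only [map_sub, map_add, map_sum, coeff_C_mul, hnat, coeff_mk]
    ring_nf at h ⊢
    linarith

/-- The image of `P` modulo `X^{K+1}` is invariant under permutations of genuine loop sequences when the coefficients up to
order `K` are. [folklore] -/
theorem P_mod_perm {P : LoopSeq d → PowerSeries ℝ} (hP : ∀ (u : LoopSeq d) (k : ℕ), coeff k (P u) = F (k + 2) β u)
    (hperm : ∀ k, k ≤ K → ∀ s s' : LoopSeq d, IsLoopSeq s → s.Perm s' → F (k + 2) β s = F (k + 2) β s')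
    (s s' : LoopSeq d) (hs : IsLoopSeq s) (h : s.Perm s') :
    Ideal.Quotient.mk (Ideal.span {(X : PowerSeries ℝ) ^ (K + 1)}) (P s) =
      Ideal.Quotient.mk (Ideal.span {(X : PowerSeries ℝ) ^ (K + 1)}) (P s') :=
  mk_eq_of_coeff_eq fun k hk => by rw [hP, hP, hperm k hk s s' hs h]

/-- `P(∅) ≡ 1` modulo `X^{K+1}` (`f_0(∅) = 1`, `f_k(∅) = 0` for `1 ≤ k ≤ K`). [folklore] -/
theorem P_mod_nil {P : LoopSeq d → PowerSeries ℝ} (hP : ∀ (u : LoopSeq d) (k : ℕ), coeff k (P u) = F (k + 2) β u)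
    (hnil : ∀ k, k ≤ K → F (k + 2) β [] = if k = 0 then 1 else 0) :
    Ideal.Quotient.mk (Ideal.span {(X : PowerSeries ℝ) ^ (K + 1)}) (P []) =
      Ideal.Quotient.mk (Ideal.span {(X : PowerSeries ℝ) ^ (K + 1)}) 1 :=
  mk_eq_of_coeff_eq fun k hk => by
    rw [hP, hnil k hk, coeff_one]

end model

end StringDuality

end Summit.QuantumFields.GaugeBoot

end
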